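import Summits.Ventures.YMGap.RobustBall.TorusOneLink
import Literature.MathematicalPhysics.QuantumFieldTheory.QuasiLocalGaugePerturbationKernels
import Literature.MathematicalPhysics.QuantumFieldTheory.Balaban1983to89.InfiniteVolumeSufficientIII
import Mathlib.Analysis.Convex.Strong
import Mathlib.Analysis.Convex.Deriv
import HarnessLib

/-!
# Venture YMGap, track ROBUST-BALL (Y2) — THE PRESSURE OF A MEMBER OF THE TORUS BALL AS A CUMULANT GENERATING FUNCTION: convexity,
# derivative = minus the energy density, and the convex-analysis toolkit (curvature moduli, second differences, differentiability)

HONEST FRAMING. WHAT THIS IS: a venture file (cell `pub-ymgap`, track Y2 ROBUST-BALL, seat rb-p2, theorems only, 0 compute): the common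
bookkeeping of this seat's free-energy files on the torus ball.  For a quasi-local gauge-invariant perturbation `W` of the `SU(N)` Wilson action
on the torus `(ℤ/L)^d` (`Perturbation d L N`, rb-theory's `Defs.lean`) and the member's pressure `p_{L,W}(t) = L^{−d} log Z_{Λ_L,t,W}`,
`Z_{Λ,t,W} = ∫ e^{−t S_W − W} ∏ dU` (lit's `QuasiLocalGaugePerturbation.partitionFunction`):
* Part A (generic, any bounded measurable `X` on a probability space): `(cgf)″ = ` the tilted variance (`iteratedDeriv_two_cgf_eq_variance`, Mathlib
  `variance_tilted_mul`); `convexOn_mul_cgf_sub_sq` (tilted variances `≥ m/c` ⇒ `c·cgf − (m/2)t²` convex) and `convexOn_sq_sub_mul_cgf`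
  (`≤ M/c` ⇒ `(M/2)t² − c·cgf` convex).
* Part B (generic real analysis): `convexOn_of_tendsto` (pointwise limits of convex functions), `strongConvexOn_real_iff`,
  `second_difference_two_sided` (`m h² ≤ f(x+h)+f(x−h)−2f(x) ≤ M h²` from the two convexities), ★ `differentiableAt_of_two_sided_convex`
  (`f − (m/2)t²` and `(M/2)t² − f` convex ⇒ `f` differentiable in the interior: the one-sided derivatives of a convex function, Mathlib
  `ConvexOn.hasDerivWithinAt_rightDeriv_of_mem_interior`, satisfy `f'₋ ≤ f'₊`, and for `(M/2)t² − f` this reads `f'₊ ≤ f'₋`), and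
  ★ `deriv_sub_deriv_two_sided` (`m(y − x) ≤ f′(y) − f′(x) ≤ M(y − x)` in the interior: `f ∈ C^{1,1}` with the two curvature moduli).
* Part C (the member): `tilted_tilted_eq_perturbedMeasure` (`μ_{Λ,t,W}` = the `t(−S_W)`-tilt of `ν_W ∝ e^{−W}∏dU`), `log_partitionFunction_eq_cgf_add`
  (`log Z_{Λ,t,W} = cgf_{ν_W}(−S_W)(t) + log Z_{Λ,0,W}`), ★ `hasDerivAt_memberPressure` (`p′_{L,W}(t) = −L^{−d}⟨S_W⟩_{Λ,t,W}` at every `t`),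
  ★ `convexOn_memberPressure` (the member pressure is convex on every segment — `p″ = L^{−d} Var ≥ 0`).
WHAT THIS IS NOT: no estimate on the curvature (those are `FreeEnergyStrongConvexityBall` — floor, every coupling — and
`FreeEnergyCurvatureCeilingBall` — ceiling, inside the door); nothing about the continuum limit or a Clay-sense mass gap.

References: B. Simon, *The Statistical Mechanics of Lattice Gases* I (1993), §II.1; Mathlib `Probability.Moments.Tilted`, `Analysis.Convex.Deriv`.
Everything here is proved; no definition, no named fact. [folklore]
-/

noncomputable section

open MeasureTheory ProbabilityTheory Finset Function Filter Topology
open Literature.MathematicalPhysics.QuantumLattice hiding torusNorm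
open Literature.MathematicalPhysics.QuantumFieldTheory hiding ZdEdge

namespace Summit.Ventures.YMGap.RobustBall

namespace EnergyVariance

/-! ### Part A — cumulant generating functions: second derivative = tilted variance; curvature moduli -/

section CGF

variable {Ω : Type*} [MeasurableSpace Ω] {μ : Measure Ω} [IsProbabilityMeasure μ] {X : Ω → ℝ} {C : ℝ}

/-- For a bounded measurable `X` every real parameter is interior to the domain of the cumulant generating function. [folklore] -/
theorem mem_interior_integrableExpSet (hX : Measurable X) (hC : ∀ ω, |X ω| ≤ C) (t : ℝ) :
    t ∈ interior (integrableExpSet X μ) := by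
  have hI : integrableExpSet X μ = Set.univ :=
    Set.eq_univ_of_forall fun t => Literature.Probability.LatticeModels.ForbiddenGap.integrable_exp_mul_of_abs_le hX hC t
  rw [hI, interior_univ]
  exact Set.mem_univ _

/-- **`(cgf)'' = ` the variance under the Gibbs tilt**: `iteratedDeriv 2 (cgf X μ) t = Var[X; μ.tilted (t X)]` for bounded measurable
`X` (Mathlib `variance_tilted_mul`). [folklore] -/
theorem iteratedDeriv_two_cgf_eq_variance (hX : Measurable X) (hC : ∀ ω, |X ω| ≤ C) (t : ℝ) :
    iteratedDeriv 2 (cgf X μ) t = Var[X; μ.tilted fun ω => t * X ω] :=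
  (variance_tilted_mul (mem_interior_integrableExpSet hX hC t)).symm

/-- `d/dt (m/2 · t²) = m t`. [folklore] -/
theorem hasDerivAt_half_mul_sq (m t : ℝ) : HasDerivAt (fun t : ℝ => m / 2 * t ^ 2) (m * t) t := by
  refine ((hasDerivAt_pow 2 t).const_mul (m / 2)).congr_deriv ?_
  rw [show (2 : ℕ) - 1 = 1 from rfl, pow_one, Nat.cast_ofNat]
  ring

/-- **A cumulant generating function with tilted variances `≥ m/c` on a segment is `m`-strongly convex there after scaling by `c`**:
if `m ≤ c · Var[X; μ.tilted (t X)]` for all `t ∈ [lo, hi]`, then `t ↦ c · cgf X μ t − (m/2) t²` is convex on `[lo, hi]`. [folklore] -/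
theorem convexOn_mul_cgf_sub_sq (hX : Measurable X) (hC : ∀ ω, |X ω| ≤ C) {c m lo hi : ℝ}
    (hvar : ∀ t ∈ Set.Icc lo hi, m ≤ c * Var[X; μ.tilted fun ω => t * X ω]) :
    ConvexOn ℝ (Set.Icc lo hi) (fun t => c * cgf X μ t - m / 2 * t ^ 2) := by
  have han : ∀ t, AnalyticAt ℝ (cgf X μ) t := fun t => analyticAt_cgf (mem_interior_integrableExpSet hX hC t)
  have hd1 : ∀ t, HasDerivAt (cgf X μ) (deriv (cgf X μ) t) t := fun t => (han t).differentiableAt.hasDerivAt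
  have hd2 : ∀ t, HasDerivAt (deriv (cgf X μ)) (iteratedDeriv 2 (cgf X μ) t) t := fun t => by
    rw [iteratedDeriv_succ, iteratedDeriv_one]
    exact (han t).deriv.differentiableAt.hasDerivAt
  have hsq : ∀ t : ℝ, HasDerivAt (fun t : ℝ => m / 2 * t ^ 2) (m * t) t := fun t => hasDerivAt_half_mul_sq m t
  set g : ℝ → ℝ := fun t => c * cgf X μ t - m / 2 * t ^ 2 with hg
  have hg1 : ∀ t, HasDerivAt g (c * deriv (cgf X μ) t - m * t) t := fun t => ((hd1 t).const_mul c).fun_sub (hsq t)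
  have hg1' : deriv g = fun t => c * deriv (cgf X μ) t - m * t := funext fun t => (hg1 t).deriv
  have hg2 : ∀ t, HasDerivAt (deriv g) (c * iteratedDeriv 2 (cgf X μ) t - m) t := fun t => by
    rw [hg1']
    exact (((hd2 t).const_mul c).fun_sub ((hasDerivAt_id' t).const_mul m)).congr_deriv (by rw [mul_one])
  refine convexOn_of_deriv2_nonneg (convex_Icc lo hi) (fun t _ => (hg1 t).continuousAt.continuousWithinAt)
    (fun t _ => (hg1 t).differentiableAt.differentiableWithinAt)
    (fun t _ => (hg2 t).differentiableAt.differentiableWithinAt) fun t ht => ?_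
  have ht' : t ∈ Set.Icc lo hi := interior_subset ht
  show 0 ≤ deriv (deriv g) t
  rw [(hg2 t).deriv, iteratedDeriv_two_cgf_eq_variance hX hC t]
  linarith [hvar t ht']

/-- **A cumulant generating function with tilted variances `≤ M/c` on a segment is `M`-smooth there after scaling by `c`**:
if `c · Var[X; μ.tilted (t X)] ≤ M` for all `t ∈ [lo, hi]`, then `t ↦ (M/2) t² − c · cgf X μ t` is convex on `[lo, hi]`. [folklore] -/
theorem convexOn_sq_sub_mul_cgf (hX : Measurable X) (hC : ∀ ω, |X ω| ≤ C) {c M lo hi : ℝ}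
    (hvar : ∀ t ∈ Set.Icc lo hi, c * Var[X; μ.tilted fun ω => t * X ω] ≤ M) :
    ConvexOn ℝ (Set.Icc lo hi) (fun t => M / 2 * t ^ 2 - c * cgf X μ t) := by
  have han : ∀ t, AnalyticAt ℝ (cgf X μ) t := fun t => analyticAt_cgf (mem_interior_integrableExpSet hX hC t)
  have hd1 : ∀ t, HasDerivAt (cgf X μ) (deriv (cgf X μ) t) t := fun t => (han t).differentiableAt.hasDerivAt
  have hd2 : ∀ t, HasDerivAt (deriv (cgf X μ)) (iteratedDeriv 2 (cgf X μ) t) t := fun t => by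
    rw [iteratedDeriv_succ, iteratedDeriv_one]
    exact (han t).deriv.differentiableAt.hasDerivAt
  set g : ℝ → ℝ := fun t => M / 2 * t ^ 2 - c * cgf X μ t with hg
  have hg1 : ∀ t, HasDerivAt g (M * t - c * deriv (cgf X μ) t) t := fun t =>
    (hasDerivAt_half_mul_sq M t).fun_sub ((hd1 t).const_mul c)
  have hg1' : deriv g = fun t => M * t - c * deriv (cgf X μ) t := funext fun t => (hg1 t).deriv
  have hg2 : ∀ t, HasDerivAt (deriv g) (M - c * iteratedDeriv 2 (cgf X μ) t) t := fun t => by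
    rw [hg1']
    exact (((hasDerivAt_id' t).const_mul M).fun_sub ((hd2 t).const_mul c)).congr_deriv (by rw [mul_one])
  refine convexOn_of_deriv2_nonneg (convex_Icc lo hi) (fun t _ => (hg1 t).continuousAt.continuousWithinAt)
    (fun t _ => (hg1 t).differentiableAt.differentiableWithinAt)
    (fun t _ => (hg2 t).differentiableAt.differentiableWithinAt) fun t ht => ?_
  have ht' : t ∈ Set.Icc lo hi := interior_subset ht
  show 0 ≤ deriv (deriv g) t
  rw [(hg2 t).deriv, iteratedDeriv_two_cgf_eq_variance hX hC t]
  linarith [hvar t ht']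

end CGF

/-! ### Part B — convex analysis on the line -/

/-- **A pointwise limit of (eventually) convex functions is convex.** [folklore] -/
theorem convexOn_of_tendsto {s : Set ℝ} (hs : Convex ℝ s) {p : ℕ → ℝ → ℝ} {f : ℝ → ℝ}
    (hconv : ∀ᶠ n in atTop, ConvexOn ℝ s (p n)) (hlim : ∀ x ∈ s, Tendsto (fun n => p n x) atTop (𝓝 (f x))) :
    ConvexOn ℝ s f := by
  refine ⟨hs, fun x hx y hy a b ha hb hab => ?_⟩
  refine le_of_tendsto_of_tendsto (hlim _ (hs hx hy ha hb hab)) (((hlim x hx).const_smul a).add ((hlim y hy).const_smul b)) ?_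
  filter_upwards [hconv] with n hn
  exact hn.2 hx hy ha hb hab

/-- On the real line, `m`-strong convexity on `s` is convexity of `t ↦ f t − (m/2) t²` on `s`. [folklore] -/
theorem strongConvexOn_real_iff {s : Set ℝ} {m : ℝ} {f : ℝ → ℝ} :
    StrongConvexOn s m f ↔ ConvexOn ℝ s (fun t => f t - m / 2 * t ^ 2) := by
  rw [strongConvexOn_iff_convex]
  have h : (fun t : ℝ => f t - m / 2 * ‖t‖ ^ 2) = fun t => f t - m / 2 * t ^ 2 := by
    funext t; rw [Real.norm_eq_abs, sq_abs]
  rw [h]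

/-- **Two-sided second differences from two-sided convexity.**  If `f − (m/2)t²` and `(M/2)t² − f` are convex on `s ∋ x − h, x + h` (convex
`s`), then `m h² ≤ f(x+h) + f(x−h) − 2 f(x) ≤ M h²`. [folklore] -/
theorem second_difference_two_sided {s : Set ℝ} {f : ℝ → ℝ} {m M x h : ℝ}
    (hlo : ConvexOn ℝ s (fun t => f t - m / 2 * t ^ 2)) (hhi : ConvexOn ℝ s (fun t => M / 2 * t ^ 2 - f t))
    (h1 : x - h ∈ s) (h2 : x + h ∈ s) :
    m * h ^ 2 ≤ f (x + h) + f (x - h) - 2 * f x ∧ f (x + h) + f (x - h) - 2 * f x ≤ M * h ^ 2 := by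
  have hx : (1 / 2 : ℝ) • (x - h) + (1 / 2 : ℝ) • (x + h) = x := by
    simp only [smul_eq_mul]; ring
  have ha : (0 : ℝ) ≤ 1 / 2 := by norm_num
  have hab : (1 / 2 : ℝ) + 1 / 2 = 1 := by norm_num
  have k1 := hlo.2 h1 h2 ha ha hab
  have k2 := hhi.2 h1 h2 ha ha hab
  rw [hx] at k1 k2
  simp only [smul_eq_mul] at k1 k2
  constructor
  · nlinarith [k1]
  · nlinarith [k2]

/-- **Two-sided convexity forces differentiability.**  If `f − (m/2)t²` and `(M/2)t² − f` are both convex on `S`, then `f` is differentiable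
at every interior point of `S` (the one-sided derivatives of a convex function exist and satisfy `f'₋ ≤ f'₊`; for `(M/2)t² − f` this reads
`f'₊ ≤ f'₋`). [folklore] -/
theorem differentiableAt_of_two_sided_convex {S : Set ℝ} {f : ℝ → ℝ} {m M x : ℝ}
    (hlo : ConvexOn ℝ S (fun t => f t - m / 2 * t ^ 2)) (hhi : ConvexOn ℝ S (fun t => M / 2 * t ^ 2 - f t))
    (hx : x ∈ interior S) : DifferentiableAt ℝ f x := by
  have r₁ := hlo.hasDerivWithinAt_rightDeriv_of_mem_interior hx
  have l₁ := hlo.hasDerivWithinAt_leftDeriv_of_mem_interior hx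
  have r₂ := hhi.hasDerivWithinAt_rightDeriv_of_mem_interior hx
  have l₂ := hhi.hasDerivWithinAt_leftDeriv_of_mem_interior hx
  have h₁ := hlo.leftDeriv_le_rightDeriv_of_mem_interior hx
  have h₂ := hhi.leftDeriv_le_rightDeriv_of_mem_interior hx
  -- the sum of the two convex functions is the smooth `((M − m)/2) t²`
  have hsum : (fun t => (f t - m / 2 * t ^ 2) + (M / 2 * t ^ 2 - f t)) = fun t => (M - m) / 2 * t ^ 2 := by
    funext t; ring
  have hsq : HasDerivAt (fun t : ℝ => (M - m) / 2 * t ^ 2) ((M - m) * x) x := hasDerivAt_half_mul_sq (M - m) x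
  have hR : derivWithin (fun t => f t - m / 2 * t ^ 2) (Set.Ioi x) x + derivWithin (fun t => M / 2 * t ^ 2 - f t) (Set.Ioi x) x =
      (M - m) * x := by
    have h := r₁.fun_add r₂
    rw [hsum] at h
    rw [← h.derivWithin (uniqueDiffWithinAt_Ioi x), hsq.hasDerivWithinAt.derivWithin (uniqueDiffWithinAt_Ioi x)]
  have hL : derivWithin (fun t => f t - m / 2 * t ^ 2) (Set.Iio x) x + derivWithin (fun t => M / 2 * t ^ 2 - f t) (Set.Iio x) x =
      (M - m) * x := by
    have h := l₁.fun_add l₂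
    rw [hsum] at h
    rw [← h.derivWithin (uniqueDiffWithinAt_Iio x), hsq.hasDerivWithinAt.derivWithin (uniqueDiffWithinAt_Iio x)]
  have heq : derivWithin (fun t => f t - m / 2 * t ^ 2) (Set.Iio x) x = derivWithin (fun t => f t - m / 2 * t ^ 2) (Set.Ioi x) x := by
    linarith
  -- hence `f − (m/2)t²` has a two-sided derivative
  have hg : HasDerivAt (fun t => f t - m / 2 * t ^ 2) (derivWithin (fun t => f t - m / 2 * t ^ 2) (Set.Ioi x) x) x := by
    have hl := (hasDerivWithinAt_Iio_iff_Iic.1 l₁)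
    rw [heq] at hl
    have hr := (hasDerivWithinAt_Ioi_iff_Ici.1 r₁)
    have hu := hl.union hr
    rw [Set.Iic_union_Ici, hasDerivWithinAt_univ] at hu
    exact hu
  have hf : (fun t => f t) = fun t => (f t - m / 2 * t ^ 2) + m / 2 * t ^ 2 := by funext t; ring
  have : DifferentiableAt ℝ (fun t => f t) x := by
    rw [hf]
    exact (hg.add (hasDerivAt_half_mul_sq m x)).differentiableAt
  exact this

/-- **Two-sided convexity pins the derivative increments**: if `f − (m/2)t²` and `(M/2)t² − f` are convex on a convex set `S`, then for interior
points `x ≤ y`: `m (y − x) ≤ f′(y) − f′(x) ≤ M (y − x)` (`f′ = deriv f`, which exists in the interior by `differentiableAt_of_two_sided_convex`). [folklore] -/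
theorem deriv_sub_deriv_two_sided {S : Set ℝ} (hS : Convex ℝ S) {f : ℝ → ℝ} {m M x y : ℝ}
    (hlo : ConvexOn ℝ S (fun t => f t - m / 2 * t ^ 2)) (hhi : ConvexOn ℝ S (fun t => M / 2 * t ^ 2 - f t))
    (hx : x ∈ interior S) (hy : y ∈ interior S) (hxy : x ≤ y) :
    m * (y - x) ≤ deriv f y - deriv f x ∧ deriv f y - deriv f x ≤ M * (y - x) := by
  have hdiff : ∀ t ∈ interior S, DifferentiableAt ℝ f t := fun t ht => differentiableAt_of_two_sided_convex hlo hhi ht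
  have hSi : Convex ℝ (interior S) := hS.interior
  -- derivatives of the two auxiliary convex functions in the interior
  have hd1 : ∀ t ∈ interior S, HasDerivAt (fun t => f t - m / 2 * t ^ 2) (deriv f t - m * t) t := fun t ht =>
    (hdiff t ht).hasDerivAt.fun_sub (hasDerivAt_half_mul_sq m t)
  have hd2 : ∀ t ∈ interior S, HasDerivAt (fun t => M / 2 * t ^ 2 - f t) (M * t - deriv f t) t := fun t ht =>
    (hasDerivAt_half_mul_sq M t).fun_sub (hdiff t ht).hasDerivAt
  have hm1 := (hlo.subset interior_subset hSi).monotoneOn_deriv (fun t ht => (hd1 t ht).differentiableAt)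
  have hm2 := (hhi.subset interior_subset hSi).monotoneOn_deriv (fun t ht => (hd2 t ht).differentiableAt)
  have k1 := hm1 hx hy hxy
  have k2 := hm2 hx hy hxy
  rw [(hd1 x hx).deriv, (hd1 y hy).deriv] at k1
  rw [(hd2 x hx).deriv, (hd2 y hy).deriv] at k2
  constructor
  · linarith
  · linarith

/-! ### Part C — the member pressure -/

section Member

variable {d L N : ℕ} [NeZero L] (ρ : SUN N →* Matrix (Fin N) (Fin N) ℂ)

/-- `e^{−W}` is integrable for the product Haar measure (bounded measurable `W`). [folklore] -/
theorem integrable_exp_neg_total (W : Perturbation d L N) :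
    Integrable (fun U : GaugeConfig d L (SUN N) => Real.exp (-W.total U)) (Measure.pi fun _ : Edge d L => haarProbability (SUN N)) := by
  obtain ⟨C, hC⟩ := W.exists_abs_total_le
  exact Literature.Probability.LatticeModels.integrable_exp_of_abs_le _ W.measurable_total.neg
    ⟨C, fun U => by rw [abs_neg]; exact hC U⟩

/-- **The member's torus state at coupling `t` is the `t(−S_W)`-tilt of the a-priori law `ν_W ∝ e^{−W} ∏ dU`.** [folklore] -/
theorem tilted_tilted_eq_perturbedMeasure (hρ : Continuous ρ) (W : Perturbation d L N) (t : ℝ) :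
    ((Measure.pi fun _ : Edge d L => haarProbability (SUN N)).tilted (fun U => -W.total U)).tilted
        (fun U : GaugeConfig d L (SUN N) => t * -wilsonAction ρ U) = W.perturbedMeasure ρ t := by
  haveI : SecondCountableTopology (Matrix (Fin N) (Fin N) ℂ) :=
    inferInstanceAs (SecondCountableTopology (Fin N → Fin N → ℂ))
  haveI : SecondCountableTopology (SUN N) := Topology.IsEmbedding.subtypeVal.secondCountableTopology
  rw [tilted_tilted (integrable_exp_neg_total W), QuasiLocalGaugePerturbation.perturbedMeasure_eq_tilted ρ hρ t W]
  congr 1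
  funext U
  simp only [Pi.add_apply]
  ring

/-- The perturbed partition function as a real integral: `Z_{Λ,t,W} = ofReal ∫ e^{−t S_W − W} ∏ dU`. [folklore] -/
theorem partitionFunction_eq_ofReal_integral (hρ : Continuous ρ) (W : Perturbation d L N) (t : ℝ) :
    W.partitionFunction ρ t = ENNReal.ofReal (∫ U, Real.exp (-t * wilsonAction ρ U - W.total U)
      ∂Measure.pi fun _ : Edge d L => haarProbability (SUN N)) := by
  haveI : SecondCountableTopology (Matrix (Fin N) (Fin N) ℂ) :=
    inferInstanceAs (SecondCountableTopology (Fin N → Fin N → ℂ))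
  haveI : SecondCountableTopology (SUN N) := Topology.IsEmbedding.subtypeVal.secondCountableTopology
  have hint : Integrable (fun U => Real.exp (-t * wilsonAction ρ U - W.total U))
      (Measure.pi fun _ : Edge d L => haarProbability (SUN N)) :=
    Literature.Probability.LatticeModels.integrable_exp_of_abs_le _
      (QuasiLocalGaugePerturbation.measurable_action ρ hρ t W) (QuasiLocalGaugePerturbation.exists_abs_action_le ρ hρ t W)
  rw [ofReal_integral_eq_lintegral_ofReal hint (ae_of_all _ fun U => (Real.exp_pos _).le)]
  simp only [QuasiLocalGaugePerturbation.partitionFunction, QuasiLocalGaugePerturbation.weight,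
    withDensity_apply _ MeasurableSet.univ, Measure.restrict_univ]

/-- **The log-partition function is the cumulant generating function of `−S_W` under `ν_W`, up to the constant `log Z_{Λ,0,W}`**:
`log Z_{Λ,t,W} = cgf_{ν_W}(−S_W)(t) + log Z_{Λ,0,W}`. [folklore] -/
theorem log_partitionFunction_eq_cgf_add (hρ : Continuous ρ) (W : Perturbation d L N) (t : ℝ) :
    Real.log (W.partitionFunction ρ t).toReal =
      cgf (fun U : GaugeConfig d L (SUN N) => -wilsonAction ρ U)
          ((Measure.pi fun _ : Edge d L => haarProbability (SUN N)).tilted fun U => -W.total U) t +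
        Real.log (W.partitionFunction ρ 0).toReal := by
  haveI : SecondCountableTopology (Matrix (Fin N) (Fin N) ℂ) :=
    inferInstanceAs (SecondCountableTopology (Fin N → Fin N → ℂ))
  haveI : SecondCountableTopology (SUN N) := Topology.IsEmbedding.subtypeVal.secondCountableTopology
  set π : Measure (GaugeConfig d L (SUN N)) := Measure.pi fun _ : Edge d L => haarProbability (SUN N) with hπ
  have hIt : ∀ s : ℝ, Integrable (fun U => Real.exp (-s * wilsonAction ρ U - W.total U)) π := fun s =>
    Literature.Probability.LatticeModels.integrable_exp_of_abs_le _
      (QuasiLocalGaugePerturbation.measurable_action ρ hρ s W) (QuasiLocalGaugePerturbation.exists_abs_action_le ρ hρ s W)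
  have hpos : ∀ s : ℝ, 0 < ∫ U, Real.exp (-s * wilsonAction ρ U - W.total U) ∂π := fun s => integral_exp_pos (hIt s)
  have hZ : ∀ s : ℝ, (W.partitionFunction ρ s).toReal = ∫ U, Real.exp (-s * wilsonAction ρ U - W.total U) ∂π := fun s => by
    rw [partitionFunction_eq_ofReal_integral ρ hρ W s, ENNReal.toReal_ofReal (hpos s).le]
  have h0 : ∫ U, Real.exp (-W.total U) ∂π = ∫ U, Real.exp (-(0 : ℝ) * wilsonAction ρ U - W.total U) ∂π := by
    congr 1; funext U; simp
  have e : (fun U : GaugeConfig d L (SUN N) => -W.total U) + (fun U => t * -wilsonAction ρ U) =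
      fun U => -t * wilsonAction ρ U - W.total U := by
    funext U; simp only [Pi.add_apply]; ring
  rw [hZ, hZ, cgf, mgf, integral_exp_tilted, e, h0, Real.log_div (hpos t).ne' (hpos 0).ne']
  ring

/-- **The derivative of the member pressure is minus the mean energy density**:
`d/dt (L^{−d} log Z_{Λ_L,t,W}) = −L^{−d} ∫ S_W dμ_{Λ_L,t,W}` at every real `t`. [folklore] -/
theorem hasDerivAt_memberPressure (hρ : Continuous ρ) (W : Perturbation d L N) (t : ℝ) :
    HasDerivAt (fun s : ℝ => ((L : ℝ) ^ d)⁻¹ * Real.log (W.partitionFunction ρ s).toReal)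
      (-(((L : ℝ) ^ d)⁻¹ * ∫ U, wilsonAction ρ U ∂W.perturbedMeasure ρ t)) t := by
  haveI : SecondCountableTopology (Matrix (Fin N) (Fin N) ℂ) :=
    inferInstanceAs (SecondCountableTopology (Fin N → Fin N → ℂ))
  haveI : SecondCountableTopology (SUN N) := Topology.IsEmbedding.subtypeVal.secondCountableTopology
  set ν : Measure (GaugeConfig d L (SUN N)) :=
    (Measure.pi fun _ : Edge d L => haarProbability (SUN N)).tilted fun U => -W.total U with hν
  haveI : IsProbabilityMeasure ν := isProbabilityMeasure_tilted (integrable_exp_neg_total W)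
  set X : GaugeConfig d L (SUN N) → ℝ := fun U => -wilsonAction ρ U with hX
  have hXm : Measurable X := (measurable_wilsonAction ρ hρ).neg
  obtain ⟨B, hB⟩ := exists_abs_wilsonAction_le (d := d) (L := L) ρ hρ
  have hXb : ∀ U, |X U| ≤ B := fun U => by rw [hX, abs_neg]; exact hB U
  have hint : t ∈ interior (integrableExpSet X ν) := mem_interior_integrableExpSet hXm hXb t
  -- the cgf is differentiable with derivative the tilted mean of `X = −S_W`
  have hcgf : HasDerivAt (cgf X ν) (∫ U, X U ∂W.perturbedMeasure ρ t) t := by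
    have h := (analyticAt_cgf hint).differentiableAt.hasDerivAt
    rw [← integral_tilted_mul_self hint] at h
    have e : ν.tilted (fun U => t * X U) = W.perturbedMeasure ρ t := tilted_tilted_eq_perturbedMeasure ρ hρ W t
    rwa [e] at h
  -- the pressure is `L^{-d} (cgf + const)`
  have hfun : (fun s : ℝ => ((L : ℝ) ^ d)⁻¹ * Real.log (W.partitionFunction ρ s).toReal) =
      fun s => ((L : ℝ) ^ d)⁻¹ * cgf X ν s + ((L : ℝ) ^ d)⁻¹ * Real.log (W.partitionFunction ρ 0).toReal := by
    funext s
    rw [log_partitionFunction_eq_cgf_add ρ hρ W s, mul_add]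
  rw [hfun]
  have h := (hcgf.const_mul (((L : ℝ) ^ d)⁻¹)).add_const (((L : ℝ) ^ d)⁻¹ * Real.log (W.partitionFunction ρ 0).toReal)
  refine h.congr_deriv ?_
  rw [hX, integral_neg, mul_neg]

/-- ★ **The member pressure is convex on every segment** (`p″ = L^{−d} Var ≥ 0`; no estimate). [folklore] -/
theorem convexOn_memberPressure (hρ : Continuous ρ) (W : Perturbation d L N) (lo hi : ℝ) :
    ConvexOn ℝ (Set.Icc lo hi) (fun t : ℝ => ((L : ℝ) ^ d)⁻¹ * Real.log (W.partitionFunction ρ t).toReal) := by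
  haveI : SecondCountableTopology (Matrix (Fin N) (Fin N) ℂ) :=
    inferInstanceAs (SecondCountableTopology (Fin N → Fin N → ℂ))
  haveI : SecondCountableTopology (SUN N) := Topology.IsEmbedding.subtypeVal.secondCountableTopology
  haveI : IsProbabilityMeasure ((Measure.pi fun _ : Edge d L => haarProbability (SUN N)).tilted
      fun U : GaugeConfig d L (SUN N) => -W.total U) := isProbabilityMeasure_tilted (integrable_exp_neg_total W)
  have hH : Measurable fun U : GaugeConfig d L (SUN N) => -wilsonAction ρ U := (measurable_wilsonAction ρ hρ).neg
  obtain ⟨B, hB⟩ := exists_abs_wilsonAction_le (d := d) (L := L) ρ hρ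
  have hB' : ∀ U : GaugeConfig d L (SUN N), |-wilsonAction ρ U| ≤ B := fun U => by rw [abs_neg]; exact hB U
  have hV : (0 : ℝ) ≤ ((L : ℝ) ^ d)⁻¹ := by positivity
  have h := convexOn_mul_cgf_sub_sq (μ := (Measure.pi fun _ : Edge d L => haarProbability (SUN N)).tilted
      fun U : GaugeConfig d L (SUN N) => -W.total U) hH hB' (c := ((L : ℝ) ^ d)⁻¹) (m := 0) (lo := lo) (hi := hi)
    (fun t _ => mul_nonneg hV (variance_nonneg _ _))
  refine (h.add_const (((L : ℝ) ^ d)⁻¹ * Real.log (W.partitionFunction ρ 0).toReal)).congr fun t _ => ?_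
  simp only [Pi.add_apply, log_partitionFunction_eq_cgf_add ρ hρ W t]
  ring

end Member

end EnergyVariance

end Summit.Ventures.YMGap.RobustBall
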